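import Summits.QuantumFields.YangMills.Theorems.LangevinControlUVOSLegsFromFemtoAndGapStubCollar6
import Summits.QuantumFields.YangMills.Theorems.LangevinControlUVOSLegsFromFemtoAndGapStubAssemblyUniformBoundPrep
import Summits.QuantumFields.BalabanUV.InfiniteVolume.LoopProductVanishing
import Literature.MathematicalPhysics.QuantumFieldTheory.GaugeOSData
import Literature.MathematicalPhysics.QuantumFieldTheory.LatticeGaugeProofs
import HarnessLib

/-!
# Infinite volume by compactness, step 1: volume-uniform centred moment bounds pass to the
# thermodynamic limit points of the torus-projective family

HONEST FRAMING (cell `ym-fleet`, seat `ym-infvol-p2`, director-ym R136 (i) «INFINITE-VOLUME ∕ CONTINUUM-FROM-UV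
ROUTE», pre-birth helper; bears on LADDER-YM R1∕R2a).  Pure soft analysis, kernel-checked; NOTHING here is a
statement about Bałaban's renormalisation group, the continuum limit, uniqueness of the infinite-volume state
(DLR), a mass gap, or Clay.  Every hypothesis is explicit; the only Yang–Mills-specific input type is the spine's
UV-leg currency `MomentBounds6 G r a` (`Cruxes.OSLegsFromFemtoAndGap.DlrCollarTransfer`, the output type of
`BalabanLadder.UV ∧ UVSeamRec`), consumed as a HYPOTHESIS.

THE TORUS-PROJECTIVE FAMILY.  The torus Wilson states `μ_{Λ_L, β}` pushed to configurations on `ℤ^d` by the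
periodic lift `torusLift L` (tree `torusState`, `toTorusObservable`, `IsInfiniteVolumeLimitAlong`,
`infiniteVolumeLimitPoints`, `oddTorusLimitPoints`); their subsequential limits exist by compactness (tree
`infiniteVolumeLimitPoints_nonempty_holds`, `oddTorusLimitPoints_nonempty`).  Track A's bounds are PER TORUS with
PER-TORUS CENTRING: `MomentBounds6` bounds `|E_L[∏ᵢ (plane qᵢ xᵢ − E_L plane qᵢ xᵢ)]| ≤ (C/R⁴)ⁿ` on every odd
torus `(ℤ/(2L+1))⁴` with `4R+8 ≤ L`, constants uniform in `L`.  This file proves that such bounds are inherited by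
EVERY thermodynamic limit point, with the limit state's own centring — the input of any «`L → ∞` first, then
`a → 0`» extraction of continuum data from infinite-volume lattice states.

WHAT IS PROVED ([folklore] throughout).
* §1 (pure measure theory) `prod_sub_eq_sum` (expansion of `∏ᵢ (uᵢ − cᵢ)` over subsets), `integral_prod_sub_const`
  (the integral of a centred product of bounded measurable functions against a finite measure is the corresponding
  finite sum), **`tendsto_integral_centred_prod`**: if `∫ ∏_{i∈t} fᵢ dP_k → ∫ ∏_{i∈t} fᵢ dμ` for every subset `t`,
  then the CENTRED moments with the moving centrings `∫ fᵢ dP_k` converge to the centred moment of `μ` with its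
  own centring (the `n`-fold form of the tree's `abs_covariance_le_of_eventually`).
* §2 (the torus-projective family) along `IsInfiniteVolumeLimitAlong ρ β L μ`: torus expectations of finite
  products of bounded continuous measurable cylinder observables converge (`tendsto_wilsonExpectation_finset_prod`,
  via the tree's `isCylinder_finset_prod`), hence so do the per-torus-centred moments
  (**`tendsto_wilsonExpectation_centred_prod`**), and an eventual torus bound passes to the limit state
  (`abs_integral_centred_prod_le_of_eventually`).
* §3 (ℤ⁴ separation ⇒ torus separation) `abs_sub_le_of_strictMono` / `torusSeparated_of_separated`: sites of `ℤ⁴`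
  that are `2R+4`-separated in some coordinate are torus-separated (`valMinAbs`) on every odd torus `2S_k+1` with
  `k` large, along any strictly increasing `S`.
* §4 **`momentBounds6_oddTorusLimitPoints`** — THE INHERITANCE: `MomentBounds6 G r a` with constants `(C, β₄, ℓ₄)`
  ⟹ for every `β ≥ β₄`, EVERY `μ ∈ oddTorusLimitPoints r β`, every plane string `q` at `ℤ⁴`-sites `x` pairwise
  `2R+4`-separated in some coordinate, `1 ≤ R`, `R·a β ≤ ℓ₄`:
  `|∫ ∏ᵢ (plane qᵢ xᵢ − ∫ plane qᵢ xᵢ dμ) dμ| ≤ (C/R⁴)ⁿ` — same constants, no torus-size side condition left.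
* §5 `exists_strictMono_forall_oddTorusLimit` — ONE odd-torus subsequence for a whole coupling sequence: for any
  `β : ℕ → ℝ` there are a strictly increasing `S` and probability measures `μ_k` with
  `IsInfiniteVolumeLimitAlong r.ρ (β k) (2S·) (μ k)` for all `k` (Tychonoff + metrisability of
  `ℕ → ProbabilityMeasure (LGConfig 4 G)`), so a continuum scheme `β_k → ∞` can be read on one volume sequence.

References: E. Seiler, LNP 159 (1982) Ch. 2; S. Chatterjee, arXiv:1803.01950 §2 (infinite-volume limits by
compactness); J. Glimm, A. Jaffe, *Quantum Physics* (1987) §6.1; A. Jaffe, E. Witten (2006) §5 (volume-uniform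
bounds and the infinite-volume limit).
-/

set_option autoImplicit false

noncomputable section

open scoped BigOperators
open MeasureTheory Filter Topology
open Literature.MathematicalPhysics.QuantumFieldTheory hiding ZdEdge
open Literature.MathematicalPhysics.QuantumLattice
open Summit.QuantumFields.YangMills.Cruxes.OSLegsFromFemtoAndGap.DlrCollarTransfer
  (torusE plane MomentBounds6 continuous_plane exists_abs_plane_le isCylinder_plane)
open Summit.QuantumFields.YangMills.Theorems.OSLegsFromFemtoAndGap (valMinAbs_intCast_of_abs_le)
open Summit.QuantumFields.BalabanUV.InfiniteVolume.LoopProductVanishing (isCylinder_finset_prod)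

namespace Summit.QuantumFields.YangMills.Theorems.InfiniteVolume

/-! ## §1 Centred products: expansion and convergence with moving centrings (pure measure theory) -/

section Core

variable {X : Type*} [MeasurableSpace X]

/-- Expansion of a product of differences over subsets:
`∏ᵢ (uᵢ − cᵢ) = Σ_{t ⊆ univ} (∏_{i∈t} uᵢ) · ∏_{i∉t} (−cᵢ)`. [folklore] -/
theorem prod_sub_eq_sum {n : ℕ} (u c : Fin n → ℝ) :
    ∏ i, (u i - c i) =
      ∑ t ∈ (Finset.univ : Finset (Fin n)).powerset, (∏ i ∈ t, u i) * ∏ i ∈ Finset.univ \ t, (-c i) := by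
  have h : ∏ i, (u i - c i) = ∏ i, (u i + -c i) := by simp [sub_eq_add_neg]
  rw [h, Finset.prod_add]

/-- A finite product of bounded measurable real functions is integrable against a finite measure. [folklore] -/
theorem integrable_finset_prod_of_bounded (ν : Measure X) [IsFiniteMeasure ν] {ι : Type*} (t : Finset ι)
    (f : ι → X → ℝ) (hfm : ∀ i, Measurable (f i)) (hfb : ∀ i, ∃ C, ∀ x, |f i x| ≤ C) :
    Integrable (fun x => ∏ i ∈ t, f i x) ν := by
  classical
  choose C hC using hfb
  refine Integrable.of_bound (C := ∏ i ∈ t, |C i|)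
    (Finset.measurable_prod t fun i _ => hfm i).aestronglyMeasurable (Eventually.of_forall fun x => ?_)
  rw [Real.norm_eq_abs, Finset.abs_prod]
  exact Finset.prod_le_prod (fun _ _ => abs_nonneg _) fun i _ => (hC i x).trans (le_abs_self _)

/-- **The integral of a centred product is the finite sum of the subset integrals**:
`∫ ∏ᵢ (fᵢ − cᵢ) dν = Σ_t (∏_{i∉t} (−cᵢ)) ∫ ∏_{i∈t} fᵢ dν` for bounded measurable `fᵢ` and a finite measure.
[folklore] -/
theorem integral_prod_sub_const (ν : Measure X) [IsFiniteMeasure ν] {n : ℕ} (f : Fin n → X → ℝ)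
    (hfm : ∀ i, Measurable (f i)) (hfb : ∀ i, ∃ C, ∀ x, |f i x| ≤ C) (c : Fin n → ℝ) :
    ∫ x, ∏ i, (f i x - c i) ∂ν =
      ∑ t ∈ (Finset.univ : Finset (Fin n)).powerset,
        (∏ i ∈ Finset.univ \ t, (-c i)) * ∫ x, ∏ i ∈ t, f i x ∂ν := by
  have hexp : (fun x => ∏ i, (f i x - c i)) =
      fun x => ∑ t ∈ (Finset.univ : Finset (Fin n)).powerset,
        (∏ i ∈ Finset.univ \ t, (-c i)) * ∏ i ∈ t, f i x := by
    funext x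
    rw [prod_sub_eq_sum (fun i => f i x) c]
    exact Finset.sum_congr rfl fun t _ => mul_comm _ _
  rw [hexp, integral_finsetSum _ fun t _ =>
    (integrable_finset_prod_of_bounded ν t f hfm hfb).const_mul _]
  exact Finset.sum_congr rfl fun t _ => integral_const_mul _ _

/-- **Centred moments converge with moving centrings.**  Let `P k` (`k ∈ ℕ`) and `μ` be finite measures and
`f₁, …, fₙ` bounded measurable.  If `∫ ∏_{i∈t} fᵢ dP_k → ∫ ∏_{i∈t} fᵢ dμ` for EVERY subset `t` (singletons
included, so the centrings converge), then
`∫ ∏ᵢ (fᵢ − ∫ fᵢ dP_k) dP_k → ∫ ∏ᵢ (fᵢ − ∫ fᵢ dμ) dμ`. [folklore] -/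
theorem tendsto_integral_centred_prod (P : ℕ → Measure X) [∀ k, IsFiniteMeasure (P k)] (μ : Measure X)
    [IsFiniteMeasure μ] {n : ℕ} (f : Fin n → X → ℝ) (hfm : ∀ i, Measurable (f i))
    (hfb : ∀ i, ∃ C, ∀ x, |f i x| ≤ C)
    (h : ∀ t : Finset (Fin n),
      Tendsto (fun k => ∫ x, ∏ i ∈ t, f i x ∂P k) atTop (𝓝 (∫ x, ∏ i ∈ t, f i x ∂μ))) :
    Tendsto (fun k => ∫ x, ∏ i, (f i x - ∫ y, f i y ∂P k) ∂P k) atTop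
      (𝓝 (∫ x, ∏ i, (f i x - ∫ y, f i y ∂μ) ∂μ)) := by
  have hc : ∀ i, Tendsto (fun k => ∫ y, f i y ∂P k) atTop (𝓝 (∫ y, f i y ∂μ)) := fun i => by
    simpa [Finset.prod_singleton] using h {i}
  have e : ∀ k, ∫ x, ∏ i, (f i x - ∫ y, f i y ∂P k) ∂P k =
      ∑ t ∈ (Finset.univ : Finset (Fin n)).powerset,
        (∏ i ∈ Finset.univ \ t, (-∫ y, f i y ∂P k)) * ∫ x, ∏ i ∈ t, f i x ∂P k :=
    fun k => integral_prod_sub_const (P k) f hfm hfb _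
  rw [show (fun k => ∫ x, ∏ i, (f i x - ∫ y, f i y ∂P k) ∂P k) = fun k =>
      ∑ t ∈ (Finset.univ : Finset (Fin n)).powerset,
        (∏ i ∈ Finset.univ \ t, (-∫ y, f i y ∂P k)) * ∫ x, ∏ i ∈ t, f i x ∂P k from funext e,
    integral_prod_sub_const μ f hfm hfb _]
  refine tendsto_finsetSum _ fun t _ => Tendsto.mul ?_ (h t)
  exact tendsto_finsetProd _ fun i _ => (hc i).neg

end Core

/-! ## §2 Along the torus-projective family: products and centred products of cylinder observables -/

section Torus

variable {d N : ℕ} {G : Type*} [Group G] [TopologicalSpace G] [IsTopologicalGroup G] [CompactSpace G]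
  [MeasurableSpace G] [BorelSpace G] (ρ : G →* Matrix (Fin N) (Fin N) ℂ)

/-- Finite products of bounded functions are bounded. [folklore] -/
theorem exists_abs_finset_prod_le {Y : Type*} {ι : Type*} (t : Finset ι) (f : ι → Y → ℝ)
    (hfb : ∀ i, ∃ C, ∀ U, |f i U| ≤ C) : ∃ C, ∀ U, |∏ i ∈ t, f i U| ≤ C := by
  classical
  choose C hC using hfb
  refine ⟨∏ i ∈ t, |C i|, fun U => ?_⟩
  rw [Finset.abs_prod]
  exact Finset.prod_le_prod (fun _ _ => abs_nonneg _) fun i _ => (hC i U).trans (le_abs_self _)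

/-- **Torus expectations of finite products of bounded continuous cylinder observables converge along the
torus-projective family** (`IsInfiniteVolumeLimitAlong`; the product is again a bounded continuous cylinder
observable, tree `isCylinder_finset_prod`). [folklore] -/
theorem tendsto_wilsonExpectation_finset_prod {β : ℝ} {L : ℕ → ℕ} {μ : Measure (LGConfig d G)}
    (hμ : IsInfiniteVolumeLimitAlong (d := d) ρ β L μ) {ι : Type*} (t : Finset ι)
    (f : ι → LGConfig d G → ℝ) (hcyl : ∀ i, ∃ S : Finset (ZdEdge d), IsCylinder (f i) S)
    (hcont : ∀ i, Continuous (f i)) (hbdd : ∀ i, ∃ C, ∀ U, |f i U| ≤ C) :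
    Tendsto (fun k => wilsonExpectation (L := L k + 1) ρ β
        (toTorusObservable (L k + 1) fun U => ∏ i ∈ t, f i U)) atTop
      (𝓝 (∫ U, ∏ i ∈ t, f i U ∂μ)) := by
  classical
  choose S hS using hcyl
  exact hμ.2 (fun U => ∏ i ∈ t, f i U) (t.biUnion S) (isCylinder_finset_prod t f S hS)
    (continuous_finsetProd t fun i _ => hcont i) (exists_abs_finset_prod_le t f hbdd)

/-- **Per-torus-centred moments converge to the centred moment of the limit state.**  Along
`IsInfiniteVolumeLimitAlong ρ β L μ`, for bounded continuous measurable cylinder observables `f₁, …, fₙ`: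
`E_{L_k+1}[∏ᵢ (fᵢ∘lift − E_{L_k+1}(fᵢ∘lift))] → ∫ ∏ᵢ (fᵢ − ∫ fᵢ dμ) dμ`. [folklore] -/
theorem tendsto_wilsonExpectation_centred_prod (hρ : Continuous ρ) {β : ℝ} {L : ℕ → ℕ}
    {μ : Measure (LGConfig d G)} (hμ : IsInfiniteVolumeLimitAlong (d := d) ρ β L μ) {n : ℕ}
    (f : Fin n → LGConfig d G → ℝ) (hcyl : ∀ i, ∃ S : Finset (ZdEdge d), IsCylinder (f i) S)
    (hcont : ∀ i, Continuous (f i)) (hmeas : ∀ i, Measurable (f i)) (hbdd : ∀ i, ∃ C, ∀ U, |f i U| ≤ C) :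
    Tendsto (fun k => wilsonExpectation (L := L k + 1) ρ β (toTorusObservable (L k + 1) fun U =>
        ∏ i, (f i U - wilsonExpectation (L := L k + 1) ρ β (toTorusObservable (L k + 1) (f i))))) atTop
      (𝓝 (∫ U, ∏ i, (f i U - ∫ V, f i V ∂μ) ∂μ)) := by
  classical
  haveI : IsProbabilityMeasure μ := hμ.1
  haveI : ∀ k, IsProbabilityMeasure (torusState (d := d) ρ β (L k + 1)) := fun k =>
    isProbabilityMeasure_torusState (d := d) (L := L k + 1) ρ hρ β
  -- every torus expectation in sight is an integral against the transported torus state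
  have hsingle : ∀ k i, wilsonExpectation (L := L k + 1) ρ β (toTorusObservable (L k + 1) (f i)) =
      ∫ V, f i V ∂(torusState (d := d) ρ β (L k + 1)) :=
    fun k i => wilsonExpectation_toTorusObservable ρ β (L k + 1) (hmeas i)
  have hprodm : ∀ (c : Fin n → ℝ), Measurable fun U : LGConfig d G => ∏ i, (f i U - c i) := fun c =>
    Finset.measurable_prod _ fun i _ => (hmeas i).sub measurable_const
  have hcentred : ∀ k, wilsonExpectation (L := L k + 1) ρ β (toTorusObservable (L k + 1) fun U =>
        ∏ i, (f i U - wilsonExpectation (L := L k + 1) ρ β (toTorusObservable (L k + 1) (f i)))) =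
      ∫ U, ∏ i, (f i U - ∫ V, f i V ∂(torusState (d := d) ρ β (L k + 1)))
        ∂(torusState (d := d) ρ β (L k + 1)) := fun k => by
    simp_rw [hsingle k]
    exact wilsonExpectation_toTorusObservable ρ β (L k + 1) (hprodm _)
  simp_rw [hcentred]
  refine tendsto_integral_centred_prod (fun k => torusState (d := d) ρ β (L k + 1)) μ f hmeas hbdd
    fun t => ?_
  have ht := tendsto_wilsonExpectation_finset_prod ρ hμ t f hcyl hcont hbdd
  have hm : Measurable fun U : LGConfig d G => ∏ i ∈ t, f i U := Finset.measurable_prod _ fun i _ => hmeas i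
  simp_rw [wilsonExpectation_toTorusObservable ρ β _ hm] at ht
  exact ht

/-- **An eventual torus bound on the centred moments passes to the limit state.** [folklore] -/
theorem abs_integral_centred_prod_le_of_eventually (hρ : Continuous ρ) {β : ℝ} {L : ℕ → ℕ}
    {μ : Measure (LGConfig d G)} (hμ : IsInfiniteVolumeLimitAlong (d := d) ρ β L μ) {n : ℕ}
    (f : Fin n → LGConfig d G → ℝ) (hcyl : ∀ i, ∃ S : Finset (ZdEdge d), IsCylinder (f i) S)
    (hcont : ∀ i, Continuous (f i)) (hmeas : ∀ i, Measurable (f i)) (hbdd : ∀ i, ∃ C, ∀ U, |f i U| ≤ C)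
    {B : ℝ}
    (hB : ∀ᶠ k in atTop, |wilsonExpectation (L := L k + 1) ρ β (toTorusObservable (L k + 1) fun U =>
        ∏ i, (f i U - wilsonExpectation (L := L k + 1) ρ β (toTorusObservable (L k + 1) (f i))))| ≤ B) :
    |∫ U, ∏ i, (f i U - ∫ V, f i V ∂μ) ∂μ| ≤ B :=
  le_of_tendsto (tendsto_wilsonExpectation_centred_prod ρ hρ hμ f hcyl hcont hmeas hbdd).abs hB

end Torus

/-! ## §3 `ℤ⁴`-separation is torus separation on all large odd tori -/

section Separation

/-- A strictly increasing sequence of naturals eventually exceeds any bound. [folklore] -/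
theorem eventually_le_of_strictMono {S : ℕ → ℕ} (hS : StrictMono S) (M : ℕ) : ∀ᶠ k in atTop, M ≤ S k :=
  (eventually_ge_atTop M).mono fun k hk => hk.trans (hS.id_le k)

/-- Coordinates of finitely many `ℤ⁴`-sites have pairwise differences bounded by a natural number. [folklore] -/
theorem exists_abs_sub_le {n : ℕ} (x : Fin n → (Fin 4 → ℤ)) :
    ∃ M : ℕ, ∀ (i j : Fin n) (m : Fin 4), |x i m - x j m| ≤ M := by
  set M' : ℤ := ∑ i, ∑ m, |x i m| with hM'
  have hle : ∀ i m, |x i m| ≤ M' := fun i m =>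
    calc |x i m| ≤ ∑ m', |x i m'| :=
          Finset.single_le_sum (f := fun m' => |x i m'|) (fun _ _ => abs_nonneg _) (Finset.mem_univ m)
      _ ≤ M' := Finset.single_le_sum (f := fun i' => ∑ m', |x i' m'|)
          (fun _ _ => Finset.sum_nonneg fun _ _ => abs_nonneg _) (Finset.mem_univ i)
  refine ⟨(M' + M').toNat, fun i j m => ?_⟩
  calc |x i m - x j m| ≤ |x i m| + |x j m| := abs_sub _ _
    _ ≤ M' + M' := add_le_add (hle i m) (hle j m)
    _ ≤ ((M' + M').toNat : ℤ) := Int.self_le_toNat _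

/-- **`ℤ⁴`-separation ⇒ torus separation, eventually.**  If the sites `x i` are pairwise `D`-separated in some
coordinate of `ℤ⁴`, then along any strictly increasing `S` they are eventually pairwise `D`-separated in the
torus sense (`valMinAbs` of the difference read in `ℤ/(2S_k+1)`) — no wrap-around once `S_k` exceeds all
coordinate differences. [folklore] -/
theorem eventually_torusSeparated {n : ℕ} (x : Fin n → (Fin 4 → ℤ)) {D : ℤ}
    (hsep : ∀ i j : Fin n, i ≠ j → ∃ m : Fin 4, D ≤ |x i m - x j m|) {S : ℕ → ℕ} (hS : StrictMono S) :
    ∀ᶠ k in atTop, ∀ i j : Fin n, i ≠ j → ∃ m : Fin 4,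
      D ≤ |((((x i m - x j m : ℤ) : ZMod (2 * S k + 1))).valMinAbs : ℤ)| := by
  obtain ⟨M, hM⟩ := exists_abs_sub_le x
  filter_upwards [eventually_le_of_strictMono hS M] with k hk i j hij
  obtain ⟨m, hm⟩ := hsep i j hij
  refine ⟨m, ?_⟩
  rwa [valMinAbs_intCast_of_abs_le ((hM i j m).trans (by exact_mod_cast hk))]

end Separation

/-! ## §4 The inheritance: `MomentBounds6` holds for every odd-torus limit state -/

section Inheritance

variable {G : Type} [Group G] [TopologicalSpace G] [IsTopologicalGroup G] [CompactSpace G]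
  [MeasurableSpace G] [BorelSpace G]

/-- The single-plane fields are measurable (second countability of `G` from the faithful representation `r`). [folklore] -/
theorem measurable_plane (r : LatticeRep G) (q : Fin 4 × Fin 4) (x : Fin 4 → ℤ) :
    Measurable (plane G r q x) := by
  haveI : SecondCountableTopology G :=
    (r.continuous.isClosedEmbedding r.injective).isEmbedding.secondCountableTopology
  exact (measurable_plaquetteObs r.ρ r.continuous 0 q.1 q.2).comp
    (Literature.MathematicalPhysics.QuantumLattice.configShift _).measurable

/-- **THE INHERITANCE.**  Let `MomentBounds6 G r a` hold (the spine's UV-leg currency: per-torus-centred mixed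
moments of single-plane fields at torus-separated sites are `≤ (C/R⁴)ⁿ` on EVERY odd torus `(ℤ/(2L+1))⁴` with
`4R+8 ≤ L`, for `β ≥ β₄`, `1 ≤ R`, `R·a β ≤ ℓ₄`).  Then, with the SAME constants, for every `β ≥ β₄` and EVERY
thermodynamic limit point `μ ∈ oddTorusLimitPoints r β` of the torus-projective family, every plane string `q` at
sites `x` of `ℤ⁴` pairwise `2R+4`-separated in some coordinate:
`|∫ ∏ᵢ (plane qᵢ xᵢ − ∫ plane qᵢ xᵢ dμ) dμ| ≤ (C/R⁴)ⁿ`.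
Proof: along the defining subsequence `S_k` the sites are eventually torus-separated and `4R+8 ≤ S_k` (§3), so the
torus bound holds eventually, and the per-torus-centred moments converge to the `μ`-centred moment (§2). [folklore] -/
theorem momentBounds6_oddTorusLimitPoints (r : LatticeRep G) {a : ℝ → ℝ} {C β₄ ℓ₄ : ℝ}
    (hMB : ∀ β : ℝ, β₄ ≤ β →
      ∀ (L n : ℕ) (q : Fin n → Fin 4 × Fin 4) (x : Fin n → (Fin 4 → ℤ)) (R : ℕ), (∀ i, (q i).1 < (q i).2) →
        1 ≤ R → (R : ℝ) * a β ≤ ℓ₄ → 4 * R + 8 ≤ L →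
        (∀ i j : Fin n, i ≠ j → ∃ k : Fin 4,
          (2 * (R : ℤ) + 4) ≤ |((((x i k - x j k : ℤ) : ZMod (2 * L + 1))).valMinAbs : ℤ)|) →
        |torusE G r β L (fun U => ∏ i, (plane G r (q i) (x i) U - torusE G r β L (plane G r (q i) (x i))))| ≤
          (C / (R : ℝ) ^ 4) ^ n)
    {β : ℝ} (hβ : β₄ ≤ β) {μ : Measure (LGConfig 4 G)} (hμ : μ ∈ oddTorusLimitPoints r β)
    {n : ℕ} (q : Fin n → Fin 4 × Fin 4) (x : Fin n → (Fin 4 → ℤ)) (R : ℕ) (hq : ∀ i, (q i).1 < (q i).2)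
    (hR : 1 ≤ R) (hRa : (R : ℝ) * a β ≤ ℓ₄)
    (hsep : ∀ i j : Fin n, i ≠ j → ∃ k : Fin 4, (2 * (R : ℤ) + 4) ≤ |x i k - x j k|) :
    |∫ U, ∏ i, (plane G r (q i) (x i) U - ∫ V, plane G r (q i) (x i) V ∂μ) ∂μ| ≤ (C / (R : ℝ) ^ 4) ^ n := by
  obtain ⟨S, hS, hlim⟩ := hμ
  obtain ⟨Cp, hCp⟩ := exists_abs_plane_le (G := G) r
  refine abs_integral_centred_prod_le_of_eventually r.ρ r.continuous hlim (fun i => plane G r (q i) (x i))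
    (fun i => ⟨_, isCylinder_plane r (q i) (x i)⟩) (fun i => continuous_plane r (q i) (x i))
    (fun i => measurable_plane r (q i) (x i)) (fun i => ⟨Cp, hCp (q i) (x i)⟩) ?_
  filter_upwards [eventually_torusSeparated x hsep hS, eventually_le_of_strictMono hS (4 * R + 8)]
    with k hsepk hRk
  exact hMB β hβ (S k) n q x R hq hR hRa hRk hsepk

/-- **`MomentBounds6` passes to the thermodynamic limit points**, packaged with the existential constants of the
spine decl: `MomentBounds6 G r a ⟹ ∃ C β₄ ℓ₄, 0 < ℓ₄ ∧ 0 ≤ C ∧` the bound of `momentBounds6_oddTorusLimitPoints`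
for all `β ≥ β₄`, all `μ ∈ oddTorusLimitPoints r β`, all `ℤ⁴`-separated plane strings. [folklore] -/
theorem momentBounds6_infiniteVolume (r : LatticeRep G) {a : ℝ → ℝ} (h : MomentBounds6 G r a) :
    ∃ (C β₄ ℓ₄ : ℝ), 0 < ℓ₄ ∧ 0 ≤ C ∧ ∀ β : ℝ, β₄ ≤ β →
      ∀ μ ∈ oddTorusLimitPoints r β,
      ∀ (n : ℕ) (q : Fin n → Fin 4 × Fin 4) (x : Fin n → (Fin 4 → ℤ)) (R : ℕ), (∀ i, (q i).1 < (q i).2) →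
        1 ≤ R → (R : ℝ) * a β ≤ ℓ₄ →
        (∀ i j : Fin n, i ≠ j → ∃ k : Fin 4, (2 * (R : ℤ) + 4) ≤ |x i k - x j k|) →
        |∫ U, ∏ i, (plane G r (q i) (x i) U - ∫ V, plane G r (q i) (x i) V ∂μ) ∂μ| ≤ (C / (R : ℝ) ^ 4) ^ n := by
  obtain ⟨C, β₄, ℓ₄, hℓ, hC, H⟩ := h
  exact ⟨C, β₄, ℓ₄, hℓ, hC, fun β hβ μ hμ n q x R hq hR hRa hsep =>
    momentBounds6_oddTorusLimitPoints r H hβ hμ q x R hq hR hRa hsep⟩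

end Inheritance

/-! ## §5 One odd-torus subsequence for a whole coupling sequence -/

section Joint

variable {G : Type} [Group G] [TopologicalSpace G] [IsTopologicalGroup G] [CompactSpace G]
  [MeasurableSpace G] [BorelSpace G]

/-- **Joint thermodynamic subsequence.**  For every sequence of couplings `β : ℕ → ℝ` there are ONE strictly
increasing sequence of odd tori `(ℤ/(2S_j+1))⁴` and probability measures `μ_k` on `ℤ⁴` gauge fields such that,
for every `k`, the torus Wilson states at coupling `β k` converge along `S` to `μ k` on all bounded continuous
cylinder observables (`IsInfiniteVolumeLimitAlong r.ρ (β k) (2S·) (μ k)`, in particular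
`μ k ∈ oddTorusLimitPoints r (β k)`).  Tychonoff for `ℕ → ProbabilityMeasure (LGConfig 4 G)` (compact,
metrisable: `G` is second countable Hausdorff through the faithful representation `r`). [folklore] -/
theorem exists_strictMono_forall_oddTorusLimit (r : LatticeRep G) (β : ℕ → ℝ) :
    ∃ S : ℕ → ℕ, StrictMono S ∧ ∃ μ : ℕ → Measure (LGConfig 4 G),
      ∀ k, IsProbabilityMeasure (μ k) ∧
        IsInfiniteVolumeLimitAlong (d := 4) r.ρ (β k) (fun j => 2 * S j) (μ k) := by
  have hρ := r.continuous
  haveI : SecondCountableTopology G := (hρ.isClosedEmbedding r.injective).isEmbedding.secondCountableTopology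
  haveI : T2Space G := (hρ.isClosedEmbedding r.injective).isEmbedding.t2Space
  haveI := fun (k n : ℕ) => isProbabilityMeasure_torusState (d := 4) (L := 2 * n + 1) r.ρ hρ (β k)
  let P : ℕ → ℕ → ProbabilityMeasure (LGConfig 4 G) := fun n k => ⟨torusState r.ρ (β k) (2 * n + 1), inferInstance⟩
  obtain ⟨ν, -, φ, hφ, hlim⟩ :=
    (isCompact_univ (X := ℕ → ProbabilityMeasure (LGConfig 4 G))).tendsto_subseq fun n => Set.mem_univ (P n)
  refine ⟨φ, hφ, fun k => (ν k : Measure (LGConfig 4 G)), fun k => ⟨inferInstance, inferInstance, ?_⟩⟩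
  intro F Sup _ hFc hFb
  obtain ⟨C, hC⟩ := hFb
  let Fb : BoundedContinuousFunction (LGConfig 4 G) ℝ :=
    BoundedContinuousFunction.ofNormedAddCommGroup F hFc C (fun U => by simpa [Real.norm_eq_abs] using hC U)
  have hk : Tendsto (fun j => P (φ j) k) atTop (𝓝 (ν k)) := by
    have := (tendsto_pi_nhds.1 hlim) k
    simpa [Function.comp] using this
  have key : Tendsto (fun j : ℕ => ∫ U, Fb U ∂(P (φ j) k : Measure (LGConfig 4 G))) atTop
      (𝓝 (∫ U, Fb U ∂(ν k : Measure (LGConfig 4 G)))) :=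
    (ProbabilityMeasure.tendsto_iff_forall_integral_tendsto.1 hk) Fb
  refine key.congr' (Eventually.of_forall fun j => ?_)
  exact (wilsonExpectation_toTorusObservable r.ρ (β k) (2 * φ j + 1) hFc.measurable).symm

/-- Corollary: limit states along one common odd-torus sequence, as members of `oddTorusLimitPoints`. [folklore] -/
theorem exists_strictMono_forall_mem_oddTorusLimitPoints (r : LatticeRep G) (β : ℕ → ℝ) :
    ∃ S : ℕ → ℕ, StrictMono S ∧ ∃ μ : ℕ → Measure (LGConfig 4 G),
      ∀ k, IsProbabilityMeasure (μ k) ∧ μ k ∈ oddTorusLimitPoints r (β k) ∧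
        IsInfiniteVolumeLimitAlong (d := 4) r.ρ (β k) (fun j => 2 * S j) (μ k) := by
  obtain ⟨S, hS, μ, hμ⟩ := exists_strictMono_forall_oddTorusLimit r β
  exact ⟨S, hS, μ, fun k => ⟨(hμ k).1, ⟨S, hS, (hμ k).2⟩, (hμ k).2⟩⟩

end Joint

end Summit.QuantumFields.YangMills.Theorems.InfiniteVolume

end
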